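import Summits.BirchSwinnertonDyer.BirchSwinnertonDyer.Theses.SemiOrdinaryEisensteinDescent
import Summits.BirchSwinnertonDyer.BirchSwinnertonDyer.Theorems.WildThreeRankOneBSDpOfJetchevMaxOfLiterature
import Summits.BirchSwinnertonDyer.BirchSwinnertonDyer.Theorems.WildThreeRankOneBSDpOfGlobalDivisibilityStepL
import HarnessLib

/-!
# Crux Ko `WildKolyvaginUpperAtThree` (stmt-BirchSwinnertonDyer-20480, route SemiOrdinaryEisensteinDescent):
# its SINGLE-CARRIER part is closed modulo print (cell `bsd-wall`, width seat `bsd-wall-soed-p2-w3` gen 0;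
# `--supports stmt-BirchSwinnertonDyer-20480`)

Ko asks, on every Heegner frame `(W, K, Dt, H, ι, P)` of the onto wild rank-one row at `3` (ClassO6, `ρ̄₃`
onto, `3`-adic tower, `r_an = 1`, `d_K` odd, `d_K ≠ −3`, `L(E^{d_K},1) ≠ 0`, `P = y_K` non-torsion), the upper
socket `SchneiderFree.Upper.IndexUpperBoundLeAt W 3 K P (v₃ c)`:
`ord₃ #Ш(E/K) + 2·ord₃ ∏_q c_q(E) + 2·v₃(c(Dt)) ≤ 2·ord₃ [E(K):ℤP]`. By Kolyvagin's structure theorem this is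
`M_∞ ≥ t := ord₃ ∏_q c_q + v₃(c)` (Jetchev 2008 Conj. 1.3, «≥» half, Manin-robust). This file records the
part of Ko that PRINT closes, and isolates the rest:

* §1 `indexUpperBoundLeAt_of_singleCarrier_of_literature` — on the frames where the whole `3`-part of
  `c(Dt)·∏_q c_q(E)` is carried by ONE prime `q₀ ∣ N` (`t ≤ ord₃ c_{q₀}`; e.g. `q₀ = 3`, Kodaira IV/IV*, `c₃ = 3`,
  every other `c_q` and `c` prime to `3`), Ko's conclusion follows from FIVE named print statements:
  (PT) `poitouTate_selmerStructure_duality_conj` (∀ `K`), (F1) `Gross1991_heegnerPoint_sub_ratTorsion_mem_E0`,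
  (3.7) `GrossLMS1991.prop37_2_frobeniusCongruence` — through utd-p3 g3's `jetchevMaxAtThree_of_literature`
  (p570933 §1: Jetchev Thm. 1.4 at `3 ∣ N`, the `bsd-jet` road-K kernel) and `globalDivisibility_of_jetchevMax_of_singleCarrier`
  (p569349) —, Kolyvagin 1990 Thm. A (`kolyvagin`) and Matar–Nekovář 2019 Thm. 0.7/§0.11 (`MatarNekovar2019.thm07_…`)
  — through utd-p3 g1's tower-free receptacle `upper_of_globalDivisibility_of_surj` (p545527/StepL §4b). NO exact-index
  hypothesis (contrast `indexBounds_of_singleCarrier_of_literature`, p573098, which needs `i3 = t3`), NO leaf,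
  NO main conjecture. CONDITIONAL on the five named facts (hypotheses); per frame.
* §2 `indexUpperBoundLeAt_of_singleCarrier_of_inputs` — the same with the two structure inputs packaged as the
  route's support item `KolyvaginStructureInputsAtThree` (stmt-…-20761 = line `birth` v2's `stub_inputs`): on
  single-carrier frames Ko ⟸ `stub_inputs` + {(PT), (F1), (3.7)}; the line's research stub `stub_minftyGeManin`
  is needed ONLY beyond the max, i.e. on frames with ≥ 2 carriers (counted with the Manin `3`-part).

WHY THIS SPLIT IS THE HONEST ONE (method census `Cruxes/WildKolyvaginUpperAtThree/NOGO-STRINGENT-SCALING-w3.md`,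
this seat): beyond the max NO finite-level refinement of Kolyvagin's method by local conditions at the bad places
can certify anything (`3^{m_max}·κ` is stringent at all carriers for every Kolyvagin system `κ`, and `M_∞` shifts
by exactly `m_max`); the residue of the row (3 413 JET-PRODUCT classes, census T17) consists ENTIRELY of frames
with ≥ 2 carriers. So §1 is exactly the provable part of Ko today. BSD is not proved for any curve by this file;
no definition, no named fact, no `sorry`.

References: [Jetchev2008] Thm. 1.4, Cor. 1.5, Conj. 1.3 (arXiv:math/0703431 p. 3); [McCallumLMS1991] §5
Lemma 5.1 (p. 303); [MatarNekovar2019] Thm. 0.7 (p. 456), §0.11 (p. 457); [GrossLMS1991] Prop. 3.7 (2);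
[MilneADT2006] I Thm. 4.10; [Kolyvagin1990] Thm. A.
-/

noncomputable section

open scoped Classical

set_option linter.dupNamespace false
set_option autoImplicit false

namespace Summit.BirchSwinnertonDyer.BirchSwinnertonDyer.Theorems.WildKolyvaginUpperAtThreeSingleCarrier

open WeierstrassCurve NumberField
  Literature.NumberTheory.EllipticCurves
  Literature.NumberTheory.EllipticCurves.ModularForms
  Literature.NumberTheory.GaloisCohomology
  Summit.BirchSwinnertonDyer.Rank1Residual
  Summit.BirchSwinnertonDyer.Rank1Residual.Additive
  Summit.BirchSwinnertonDyer.Rank1Residual.X11b.Three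
  Summit.BirchSwinnertonDyer.BirchSwinnertonDyer.Theorems.SchneiderFree

/-! ### §1 Ko on single-carrier frames ⟸ five named print statements -/

/-- **Ko's conclusion on SINGLE-CARRIER frames, from print.** Under the binders of crux Ko
`WildKolyvaginUpperAtThree` (onto wild rank-one row at `3`: `ClassO6 W 3`, `ρ̄₃` onto, `r_an = 1`, `N = N_E`, `K`
imaginary quadratic Heegner for `N`, `L(E^{d_K},1) ≠ 0`, `P = y_K` of the datum `(Dt, H, ι)` of infinite order,
`d_K` odd, `d_K ≠ −3`, `TowerSurjThree W`) and ONE extra hypothesis — a prime `q₀ ∣ N` carries the whole `3`-part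
of `c(Dt)·∏_q c_q(E)`: `ord₃ ∏_q c_q(E) + v₃(c(Dt)) ≤ ord₃ c_{q₀}(E)` (`hcar`) — the socket
`Upper.IndexUpperBoundLeAt W 3 K P (v₃ c)` holds GIVEN (PT), (F1), (3.7), Kolyvagin's Thm. A and Matar–Nekovář
Thm. 0.7 (all named, hypotheses). Proof: Jetchev's Thm. 1.4 at `3 ∣ N` (`SchneiderFree.Exact.jetchevMaxAtThree_of_literature`)
gives `3^{s′}`-divisibility of every derived Heegner point to depth `ord₃ c_{q₀}`, hence (`hcar`,
`globalDivisibility_of_jetchevMax_of_singleCarrier`) to depth `ord₃ ∏ c_q + v₃(c)`; the tower-free receptacle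
`SchneiderFree.Exact.upper_of_globalDivisibility_of_surj` (Kolyvagin + Matar–Nekovář upper half, McCallum's
Lemma 5.1 for `M₀`) turns that into the socket. [cite: Jetchev2008, Thm. 1.4 and Cor. 1.5 (arXiv:math/0703431 p. 3)]
[cite: MatarNekovar2019, Thm. 0.7 (p. 456) and §0.11 (p. 457)] [cite: McCallumLMS1991, §5 Lemma 5.1 (p. 303)] -/
theorem indexUpperBoundLeAt_of_singleCarrier_of_literature
    (hPT : ∀ (K : Type) [Field K] [NumberField K], poitouTate_selmerStructure_duality_conj K)
    (hF1 : Gross1991_heegnerPoint_sub_ratTorsion_mem_E0)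
    (h372 : GrossLMS1991.prop37_2_frobeniusCongruence)
    (hKo : ∀ (N : ℕ) [NeZero N] (W : WeierstrassCurve ℚ) (K : Type) [Field K] [NumberField K],
      kolyvagin N W K)
    (hMN : MatarNekovar2019.thm07_padicValNat_card_sha_primary_add_le_of_globalDivisibility_of_irreducible)
    (W : WeierstrassCurve ℚ) [W.IsElliptic] [W.IsGloballyMinimal] (N : ℕ) [NeZero N] (K : Type) [Field K]
    [NumberField K] (Dt : ModularParametrizationData W N) (H : HeegnerDatum N (NumberField.discr K))
    (ι : K →+* ℂ) (P : (W.baseChange K).toAffine.Point)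
    (hO6 : ClassO6 W 3) (hsurj : W.HasSurjectiveModNGaloisRep 3) (hr : W.analyticRank = 1)
    (hN : W.conductorNorm ℤ = N) (hK : IsImaginaryQuadratic K) (hHH : SatisfiesHeegnerHypothesis N K)
    (hLd : (W.quadraticTwist (NumberField.discr K : ℚ)).entireLFunction 1 ≠ 0)
    (hP : WeierstrassCurve.Affine.Point.map ι.toRatAlgHom P = heegnerPointComplex Dt H)
    (hnt : ¬ IsOfFinAddOrder P) (hodd : Odd (NumberField.discr K)) (h3 : NumberField.discr K ≠ -3)
    (htow : AdditiveThree.TowerSurjThree W)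
    {q₀ : ℕ} [Fact q₀.Prime] (hq₀ : q₀ ∣ N)
    (hcar : padicValNat 3 W.tamagawaProduct + padicValNat 3 Dt.c.natAbs ≤
      padicValNat 3 ((W.baseChange ℚ_[q₀]).localTamagawaNumber ℤ_[q₀])) :
    Upper.IndexUpperBoundLeAt W 3 K P (padicValNat 3 Dt.c.natAbs) := by
  subst hN
  -- `d_K ≠ -4` from `d_K` odd
  have h4 : NumberField.discr K ≠ -4 := by
    intro h
    rw [h] at hodd
    exact (Int.not_odd_iff_even.mpr ⟨-2, by norm_num⟩) hodd
  -- Jetchev Thm. 1.4 at `3 ∣ N` on this frame (max-form, every carrier), from (PT), (F1), (3.7)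
  have hJmax := Exact.jetchevMaxAtThree_of_literature hPT hF1 h372 W (W.conductorNorm ℤ) K Dt H ι P hO6
    hsurj hr rfl hK hHH hLd hP hnt hodd h3 htow
  -- single carrier: max-form ⟹ Σ-form at this frame
  have hglob := Exact.globalDivisibility_of_jetchevMax_of_singleCarrier (p := 3) hJmax hq₀ hcar
  -- the tower-free receptacle (Kolyvagin + Matar–Nekovář)
  exact Exact.upper_of_globalDivisibility_of_surj hKo hMN W 3 (by decide) hsurj K hK h3 h4 hHH Dt H ι P hP
    hnt hglob

/-! ### §2 The same, with the structure inputs packaged as the route's support item (line `birth` v2 `stub_inputs`) -/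

/-- **Ko on single-carrier frames ⟸ `stub_inputs` + {(PT), (F1), (3.7)}.** With the two structure inputs read
off the route's support item `KolyvaginStructureInputsAtThree` (stmt-BirchSwinnertonDyer-20761 = line `birth`
v2's `stub_inputs`: Kolyvagin Thm. A ∧ Matar–Nekovář Thm. 0.7), §1 says: on every Ko-frame whose `3`-part of
`c·∏c_q` has a single carrier, Ko's socket holds given (PT), (F1), (3.7). Hence the line's research stub
`stub_minftyGeManin` (Σ-form, class currency) is load-bearing ONLY on frames with at least two carriers (counted
with the Manin `3`-part) — by census T17 that is the entire residue (3 413 JET-PRODUCT classes), and by the method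
census NOGO-STRINGENT-SCALING-w3 no local-condition refinement of Kolyvagin's method reaches those.
[cite: Jetchev2008, Thm. 1.4, Cor. 1.5 and Conj. 1.3 (arXiv:math/0703431 p. 3)] -/
theorem indexUpperBoundLeAt_of_singleCarrier_of_inputs
    (hS : Theses.SemiOrdinaryEisensteinDescent.KolyvaginStructureInputsAtThree)
    (hPT : ∀ (K : Type) [Field K] [NumberField K], poitouTate_selmerStructure_duality_conj K)
    (hF1 : Gross1991_heegnerPoint_sub_ratTorsion_mem_E0)
    (h372 : GrossLMS1991.prop37_2_frobeniusCongruence)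
    (W : WeierstrassCurve ℚ) [W.IsElliptic] [W.IsGloballyMinimal] (N : ℕ) [NeZero N] (K : Type) [Field K]
    [NumberField K] (Dt : ModularParametrizationData W N) (H : HeegnerDatum N (NumberField.discr K))
    (ι : K →+* ℂ) (P : (W.baseChange K).toAffine.Point)
    (hO6 : ClassO6 W 3) (hsurj : W.HasSurjectiveModNGaloisRep 3) (hr : W.analyticRank = 1)
    (hN : W.conductorNorm ℤ = N) (hK : IsImaginaryQuadratic K) (hHH : SatisfiesHeegnerHypothesis N K)
    (hLd : (W.quadraticTwist (NumberField.discr K : ℚ)).entireLFunction 1 ≠ 0)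
    (hP : WeierstrassCurve.Affine.Point.map ι.toRatAlgHom P = heegnerPointComplex Dt H)
    (hnt : ¬ IsOfFinAddOrder P) (hodd : Odd (NumberField.discr K)) (h3 : NumberField.discr K ≠ -3)
    (htow : AdditiveThree.TowerSurjThree W)
    {q₀ : ℕ} [Fact q₀.Prime] (hq₀ : q₀ ∣ N)
    (hcar : padicValNat 3 W.tamagawaProduct + padicValNat 3 Dt.c.natAbs ≤
      padicValNat 3 ((W.baseChange ℚ_[q₀]).localTamagawaNumber ℤ_[q₀])) :
    Upper.IndexUpperBoundLeAt W 3 K P (padicValNat 3 Dt.c.natAbs) :=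
  indexUpperBoundLeAt_of_singleCarrier_of_literature hPT hF1 h372 hS.1 hS.2 W N K Dt H ι P hO6 hsurj hr hN hK
    hHH hLd hP hnt hodd h3 htow hq₀ hcar

end Summit.BirchSwinnertonDyer.BirchSwinnertonDyer.Theorems.WildKolyvaginUpperAtThreeSingleCarrier

end
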